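import Mathlib
import Literature.LinearAlgebra.Alternating.WedgeWordsBasis

/-!
# Route `TropicalKugaSatakeCayley`, support S5 `CayleyHodgeRankTwo` (stmt-HodgeConjecture-18573) — part B2:
# the coordinate dual frame of `ℝ⁸ ⊕ ℝ⁸` indexed by `Fin 16`, and tables of monomial combinations

The explicit flat forms of part B are integral combinations of the increasing wedge monomials
`frameWord ℂ θ₀ k w` (`Literature/LinearAlgebra/Alternating/WedgeWordsBasis`) of the COORDINATE FRAME of
`Λ_ℝ = ℝ⁸_x ⊕ ℝ⁸_y`, indexed by `Fin 16` through `finSumFinEquiv` (`x`-coordinates `0..7`, `y`-coordinates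
`8..15`) so that words are linearly ordered:

* `tkc_coordFrame_dual` — the coordinate functionals `θ_a = proj (e a)` and the basis vectors
  `b_a = Pi.single (e a) 1` (`e = finSumFinEquiv.symm`) form a dual frame, `θ_a(b_c) = δ_ac`;
* `tkc_combination_apply_strictMono` — **the table of a monomial combination**: for a finite set `S` of
  strictly increasing words and integer coefficients `a`,
  `(Σ_{w ∈ S} a_w · θ_w)(b ∘ v) = (v ∈ S ? a_v : 0)` for every strictly increasing `v` (duality
  `frameWord_apply_comp_strictMono`);
* `tkc_combination_apply_word_mem_range_ratCast` — such a combination takes RATIONAL (indeed integral) values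
  on every word of basis vectors (sorting / repeated letters), the rationality input of the transport
  (part C).

Theorems only: no definition, no named fact, no sorry.

## References

* [Warner1983] F. W. Warner, Foundations of Differentiable Manifolds and Lie Groups (1983), 2.6.
* [LangeBirkenhake1992] H. Lange, Ch. Birkenhake, Complex Abelian Varieties (1992), §1.1.3–1.1.4.
-/

noncomputable section

set_option linter.dupNamespace false

namespace Summit.HodgeConjecture.HodgeConjecture.Theorems

open Literature.LinearAlgebra.Alternating

section CoordinateFrame

/-- **The coordinate dual frame of `ℝ⁸ ⊕ ℝ⁸` indexed by `Fin 16`**: `θ_a(b_c) = δ_ac` for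
`θ_a = proj (e a)`, `b_c = Pi.single (e c) 1`, `e = finSumFinEquiv⁻¹`. [folklore] -/
theorem tkc_coordFrame_dual (a c : Fin 16) :
    (ContinuousLinearMap.proj (R := ℝ) (φ := fun _ : Fin 8 ⊕ Fin 8 => ℝ) (finSumFinEquiv.symm a))
        (Pi.single (finSumFinEquiv.symm c) (1 : ℝ) : Fin 8 ⊕ Fin 8 → ℝ) =
      if a = c then (1 : ℝ) else 0 := by
  rw [ContinuousLinearMap.proj_apply, Pi.single_apply]
  simp only [Equiv.apply_eq_iff_eq]

variable {E : Type*} [NormedAddCommGroup E] [NormedSpace ℝ E] {ι' : Type*} [LinearOrder ι']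
  (θ₀ : ι' → (E →L[ℝ] ℝ)) (bv : ι' → E) (hdual : ∀ i j, θ₀ i (bv j) = if i = j then 1 else 0)

include hdual in
/-- **The table of a monomial combination on increasing words**: for a finite set `S` of strictly
increasing words and coefficients `a`, `(Σ_{w ∈ S} a_w θ_w)(b_{v 0}, …, b_{v (k-1)}) = a_v` if `v ∈ S`
and `0` otherwise, for every strictly increasing `v`. [cite: Warner1983, 2.6] -/
theorem tkc_combination_apply_strictMono {k : ℕ} (S : Finset (Fin k → ι')) (hS : ∀ w ∈ S, StrictMono w)
    (a : (Fin k → ι') → ℤ) {v : Fin k → ι'} (hv : StrictMono v) :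
    (∑ w ∈ S, (a w : ℂ) • frameWord ℂ θ₀ k w) (fun i => bv (v i)) =
      ((if v ∈ S then a v else 0 : ℤ) : ℂ) := by
  classical
  rw [ContinuousAlternatingMap.sum_apply]
  have hterm : ∀ w ∈ S, ((a w : ℂ) • frameWord ℂ θ₀ k w) (fun i => bv (v i)) =
      if w = v then (a w : ℂ) else 0 := by
    intro w hw
    rw [ContinuousAlternatingMap.smul_apply, show (fun i => bv (v i)) = bv ∘ v from rfl,
      frameWord_apply_comp_strictMono θ₀ bv hdual (hS w hw) hv]
    split_ifs <;> simp
  rw [Finset.sum_congr rfl hterm, Finset.sum_ite_eq' S v]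
  split_ifs <;> simp

include hdual in
/-- **Monomial combinations with integer coefficients take rational values on every word of basis
vectors** (a repeated letter gives `0`; an injective word is a signed increasing word).
[cite: LangeBirkenhake1992, §1.1.4] -/
theorem tkc_combination_apply_word_mem_range_ratCast {k : ℕ} (S : Finset (Fin k → ι'))
    (hS : ∀ w ∈ S, StrictMono w) (a : (Fin k → ι') → ℤ) (u : Fin k → ι') :
    (∑ w ∈ S, (a w : ℂ) • frameWord ℂ θ₀ k w) (fun i => bv (u i)) ∈ Set.range (algebraMap ℚ ℂ) := by
  classical
  by_cases hu : Function.Injective u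
  · -- sort the word
    have hbv : Function.Injective bv := by
      intro i j hij
      have h := hdual i j
      rw [← hij, hdual i i, if_pos rfl] at h
      by_contra hne
      rw [if_neg hne] at h
      exact one_ne_zero h
    have h1 : (fun i => bv (u i)) = (fun i => bv ((u ∘ Tuple.sort u) i)) ∘ (Tuple.sort u).symm := by
      funext i
      simp only [Function.comp_apply, Equiv.apply_symm_apply]
    have hmono : StrictMono (u ∘ Tuple.sort u) :=
      (Tuple.monotone_sort u).strictMono_of_injective (hu.comp (Tuple.sort u).injective)
    rw [h1, ← ContinuousAlternatingMap.coe_toAlternatingMap, AlternatingMap.map_perm,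
      ContinuousAlternatingMap.coe_toAlternatingMap,
      tkc_combination_apply_strictMono θ₀ bv hdual S hS a hmono, Units.smul_def,
      ← Int.cast_smul_eq_zsmul ℂ, smul_eq_mul, ← Int.cast_mul]
    exact ⟨((Equiv.Perm.sign (Tuple.sort u).symm : ℤ) *
      (if u ∘ Tuple.sort u ∈ S then a (u ∘ Tuple.sort u) else 0) : ℤ), by
        split_ifs <;> simp⟩
  · refine ⟨0, ?_⟩
    rw [map_zero]
    exact ((∑ w ∈ S, (a w : ℂ) • frameWord ℂ θ₀ k w).map_eq_zero_of_not_injective _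
      fun h => hu (Function.Injective.of_comp (f := bv) h)).symm

end CoordinateFrame

end Summit.HodgeConjecture.HodgeConjecture.Theorems

end
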